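import Summits.QuantumFields.YangMills.Theorems.UnitScaleTiltFluctuationComparisonRegPrMiddleBondRepair
import Summits.QuantumFields.YangMills.Theorems.UnitScaleTiltBlockAvgCorrector
import Literature.MathematicalPhysics.QuantumFieldTheory.Balaban1983to89.LatticeWordStokes
import Literature.MathematicalPhysics.QuantumFieldTheory.Balaban1983to89.T3SmallLiftHistory

/-!
# Route `UnitScaleTilt` — crux K1bR-pr `FluctuationComparisonRegPr` (stmt-QuantumFields-19201), stub `stub_oneStepSmallLift`
# (W7 line), step 3: `OneStepSmallLift ⇐ APPROXIMATE SMALL LIFT` — the registered stub reduced to an approximate lift with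
# second-order averaging error (support file `--supports stmt-QuantumFields-19201`)

Cell `ym3-torus` (rung R3), seat `ym3-torus-p2` gen 8.  With the middle-bond repair of `…MiddleBondRepair` («exactness is free») the
EXACT one-step lift of the registered stub

  `stub_oneStepSmallLift : ∀ L, ∃ κ δ₀, κ√L ≤ 1 ∧ 0 < δ₀ ∧ ∀ F, F.L = L → OneStepSmallLift F ℰp κ δ₀`

is reduced to an APPROXIMATE one: a fine configuration with plaquettes `< κ₀δ` whose (0.4)/EML average is within `C·δ²` of the
given `δ`-small coarse configuration, bondwise in the matrix norm (`ApproxLiftStep`, `ApproxSmallLift`), with `κ₀√L < 1` STRICTLY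
(the repair costs `O(δ₀)` in the gain).  This is exactly the shape delivered by exponentiating a bounded LINEAR lift of the abelianised
problem — WATCH W7 of the cell: certified with `κ_lin(3) ≤ 0.4656 < 3^{-1/2}` (kit j252909, exact rational) and `κ_lin(L) ≤ 8L⁴/(L²+1)³ <
L^{-1/2}` for odd `L ≥ 5` — plus second-order BCH bookkeeping; no implicit-function argument over the whole lattice and no volume
dependence remain (cell record HOME/IR-NODE.md §15).

* §1 plaquette bookkeeping: `plaqHol` is `4`-Lipschitz bondwise (`dist1_plaqHol_le_add`); the index count `|I| = 36L³` is `BlockAvgCorrector.card_idx_T3` (p1 g9).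
* §2 `ApproxLiftStep`, and **`smallLiftStep_of_approx`**: approximate lift + loops in the guard + accuracy below `rhoU |I| /(2|I|)`
  ⇒ `SmallLiftStep P j ℰp κ δ` for every `κ` with `κ₀δ + 8|I|η ≤ κδ`.
* §3 the family: `ApproxSmallLift F κ₀ C δ₀` ⇒ `OneStepSmallLift F ℰp (κ₀ + 8|I|Cδ₁) δ₁` for an explicit `δ₁ ≤ δ₀`
  (`oneStepSmallLift_of_approx`), and the STUB SHAPE **`oneStepSmallLift_stub_of_approx`**:
  `[∀ L, ∃ κ₀ C δ₀, 0 ≤ κ₀ ∧ κ₀√L < 1 ∧ 0 ≤ C ∧ 0 < δ₀ ∧ ∀ F, F.L = L → ApproxSmallLift F κ₀ C δ₀]` ⇒ the registered signature verbatim.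

Elementary; nothing of Bałaban's is asserted.
-/

noncomputable section

open NormedSpace Set Metric Function Filter Topology
open scoped RealInnerProductSpace Quaternion NNReal Matrix.Norms.L2Operator

namespace Summit.QuantumFields.YangMills.Theorems.ApproxLift

open Literature.MathematicalPhysics.QuantumFieldTheory.Balaban1983to89
open Literature.MathematicalPhysics.QuantumFieldTheory.Balaban1983to89.T4Continuum
open Literature.MathematicalPhysics.QuantumFieldTheory.Balaban1983to89.AveragingRT
open Literature.MathematicalPhysics.QuantumFieldTheory.Balaban1983to89.BlockAveraging
open Literature.MathematicalPhysics.QuantumFieldTheory.Balaban1983to89.BlockAveragingHaarAC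
open Literature.MathematicalPhysics.QuantumFieldTheory.Balaban1983to89.BlockAveragingEMLHaarAC
open Literature.MathematicalPhysics.QuantumFieldTheory.Balaban1983to89.ExpMeanLog
open Literature.MathematicalPhysics.QuantumFieldTheory.Balaban1983to89.T3ContinuumYM3Torus
open Literature.MathematicalPhysics.QuantumFieldTheory.Balaban1983to89.T3UnitLawDensityEML (ℰp)
open Literature.MathematicalPhysics.QuantumFieldTheory.Balaban1983to89.T3SmallLiftHistory
open Literature.MathematicalPhysics.QuantumLattice (su2Quat norm_su2Quat)
open T4HaarSU2Translate (su2Quat_mul su2Quat_one)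
open Summit.QuantumFields.YangMills.Theorems.MiddleBondRepair

/-! ## §1 Plaquette bookkeeping -/

section Plaquette

variable {P : Params} {j : ℕ}

/-- `mdist` of inverses. -/
theorem mdist_inv (A A' : Matrix.specialUnitaryGroup (Fin 2) ℂ) : mdist A⁻¹ A'⁻¹ = mdist A A' := by
  rw [mdist_eq, mdist_eq, su2Quat_inv, su2Quat_inv, ← star_sub, norm_star]

/-- `mdist` of products: `‖AB − A′B′‖ ≤ ‖A − A′‖ + ‖B − B′‖` on `SU(2)`. -/
theorem mdist_mul_le (A B A' B' : Matrix.specialUnitaryGroup (Fin 2) ℂ) : mdist (A * B) (A' * B') ≤ mdist A A' + mdist B B' := by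
  rw [mdist_eq, mdist_eq, mdist_eq, su2Quat_mul, su2Quat_mul]
  have h : su2Quat A * su2Quat B - su2Quat A' * su2Quat B' =
      (su2Quat A - su2Quat A') * su2Quat B + su2Quat A' * (su2Quat B - su2Quat B') := by
    rw [sub_mul, mul_sub]; abel
  rw [h]
  calc ‖(su2Quat A - su2Quat A') * su2Quat B + su2Quat A' * (su2Quat B - su2Quat B')‖
      ≤ ‖(su2Quat A - su2Quat A') * su2Quat B‖ + ‖su2Quat A' * (su2Quat B - su2Quat B')‖ := norm_add_le _ _
    _ = ‖su2Quat A - su2Quat A'‖ + ‖su2Quat B - su2Quat B'‖ := by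
      rw [norm_mul, norm_mul, norm_su2Quat, norm_su2Quat, mul_one, one_mul]

/-- **`plaqHol` IS `4`-LIPSCHITZ BONDWISE**: if every bond variable of `U` is within `r` of that of `U′`, every plaquette variable of
`U` is within `dist1 (U′(∂p)) + 4r` of `1`. -/
theorem dist1_plaqHol_le_add (U U' : GaugeField P j (Matrix.specialUnitaryGroup (Fin 2) ℂ)) {r : ℝ}
    (hr : ∀ b, mdist (U b) (U' b) ≤ r) (p : Plaq P j) :
    dist1 (GaugeField.plaqHol U p) ≤ dist1 (GaugeField.plaqHol U' p) + 4 * r := by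
  rw [dist1_eq_mdist, dist1_eq_mdist]
  have h := mdist_triangle (GaugeField.plaqHol U p) (GaugeField.plaqHol U' p) 1
  have hprod : mdist (GaugeField.plaqHol U p) (GaugeField.plaqHol U' p) ≤ 4 * r := by
    unfold GaugeField.plaqHol
    calc mdist (U ⟨p.src, p.μ⟩ * U ⟨p.src.shift p.μ, p.ν⟩ * (U ⟨p.src.shift p.ν, p.μ⟩)⁻¹ * (U ⟨p.src, p.ν⟩)⁻¹)
          (U' ⟨p.src, p.μ⟩ * U' ⟨p.src.shift p.μ, p.ν⟩ * (U' ⟨p.src.shift p.ν, p.μ⟩)⁻¹ * (U' ⟨p.src, p.ν⟩)⁻¹)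
        ≤ mdist (U ⟨p.src, p.μ⟩ * U ⟨p.src.shift p.μ, p.ν⟩ * (U ⟨p.src.shift p.ν, p.μ⟩)⁻¹)
            (U' ⟨p.src, p.μ⟩ * U' ⟨p.src.shift p.μ, p.ν⟩ * (U' ⟨p.src.shift p.ν, p.μ⟩)⁻¹) +
          mdist (U ⟨p.src, p.ν⟩)⁻¹ (U' ⟨p.src, p.ν⟩)⁻¹ := mdist_mul_le _ _ _ _
      _ ≤ (mdist (U ⟨p.src, p.μ⟩ * U ⟨p.src.shift p.μ, p.ν⟩) (U' ⟨p.src, p.μ⟩ * U' ⟨p.src.shift p.μ, p.ν⟩) +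
            mdist (U ⟨p.src.shift p.ν, p.μ⟩)⁻¹ (U' ⟨p.src.shift p.ν, p.μ⟩)⁻¹) + mdist (U ⟨p.src, p.ν⟩)⁻¹ (U' ⟨p.src, p.ν⟩)⁻¹ := by
          gcongr; exact mdist_mul_le _ _ _ _
      _ ≤ ((mdist (U ⟨p.src, p.μ⟩) (U' ⟨p.src, p.μ⟩) + mdist (U ⟨p.src.shift p.μ, p.ν⟩) (U' ⟨p.src.shift p.μ, p.ν⟩)) +
            mdist (U ⟨p.src.shift p.ν, p.μ⟩)⁻¹ (U' ⟨p.src.shift p.ν, p.μ⟩)⁻¹) + mdist (U ⟨p.src, p.ν⟩)⁻¹ (U' ⟨p.src, p.ν⟩)⁻¹ := by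
          gcongr; exact mdist_mul_le _ _ _ _
      _ ≤ ((r + r) + r) + r := by
          rw [mdist_inv, mdist_inv]
          gcongr <;> exact hr _
      _ = 4 * r := by ring
  linarith [mdist_nonneg (GaugeField.plaqHol U' p) 1]

/-- THE STOKES CONSTANT `((d+2)L)²/4` of `LatticeWordStokes.dist1_loopHol_le` (loop variables versus plaquette variables). -/
def stokes (P : Params) : ℝ := (((P.d + 2) * P.L : ℕ) : ℝ) ^ 2 / 4

/-- `0 ≤ stokes P`. -/
theorem stokes_nonneg (P : Params) : 0 ≤ stokes P := by unfold stokes; positivity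

/-- Loop variables of a `δ′`-small field are within `stokes P · δ′` of `1`. -/
theorem dist1_loopHol_le' {δ' : ℝ} (hδ' : 0 ≤ δ') {U : GaugeField P j (Matrix.specialUnitaryGroup (Fin 2) ℂ)}
    (hU : PlaqSmall δ' U) (c : PBond P (j + 1)) (i : Idx P) : dist1 (loopHol U c i) ≤ stokes P * δ' :=
  LatticeWordStokes.dist1_loopHol_le hδ' hU c i

end Plaquette

/-! ## §2 The approximate lift schema and the exact one-step lift -/

section Step

variable {P : Params} {j : ℕ}

/-- **APPROXIMATE ONE-STEP LIFT** (hypothesis schema): every `δ`-small coarse configuration `V` is, up to a bondwise error `η` in the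
matrix norm, the (0.4)/EML block average of a `κ₀δ`-small fine configuration.  (What the certified LINEAR lift of WATCH W7 gives after
exponentiation, with `η = O(δ²)`.) -/
def ApproxLiftStep (P : Params) (j : ℕ) (κ₀ η δ : ℝ) : Prop :=
  ∀ V : GaugeField P (j + 1) (Matrix.specialUnitaryGroup (Fin 2) ℂ), PlaqSmall δ V →
    ∃ U : GaugeField P j (Matrix.specialUnitaryGroup (Fin 2) ℂ), PlaqSmall (κ₀ * δ) U ∧
      ∀ c, mdist (V c) (avgFun expMeanLogSU U c) ≤ η

/-- **`SmallLiftStep ⇐ ApproxLiftStep` («EXACTNESS IS FREE»)**: if the approximate lift has plaquettes `< κ₀δ` with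
`stokes P · κ₀δ ≤ rhoU |I|` (loops in the solvability region) and accuracy `η ≤ rhoU |I| / (2|I|)`, then repairing the central bonds
(`MiddleBondRepair.exists_exact_repair`) gives an EXACT lift with plaquettes `< κ₀δ + 8|I|η ≤ κδ`. -/
theorem smallLiftStep_of_approx (hj : j + 1 ≤ P.m + P.K) {κ₀ κ η δ : ℝ} (hκ₀ : 0 ≤ κ₀) (hδ : 0 ≤ δ) (hη0 : 0 ≤ η)
    (hη : η ≤ rhoU (Fintype.card (Idx P)) / (2 * Fintype.card (Idx P)))
    (hloops : stokes P * (κ₀ * δ) ≤ rhoU (Fintype.card (Idx P)))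
    (hκ : κ₀ * δ + 8 * Fintype.card (Idx P) * η ≤ κ * δ) (happ : ApproxLiftStep P j κ₀ η δ) :
    SmallLiftStep P j ℰp κ δ := by
  intro V hV
  obtain ⟨Ustar, hUs, hUV⟩ := happ V hV
  have hloop : ∀ c i, dist1 (loopHol Ustar c i) ≤ rhoU (Fintype.card (Idx P)) := fun c i =>
    (dist1_loopHol_le' (mul_nonneg hκ₀ hδ) hUs c i).trans hloops
  obtain ⟨U, hUavg, -, hUd⟩ := exists_exact_repair hj Ustar V hη0 hloop hη hUV
  refine ⟨U, ?_, fun p => ?_⟩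
  · show avgFun expMeanLogSU U = V
    exact hUavg
  · have h := dist1_plaqHol_le_add U Ustar hUd p
    have h' := hUs p
    nlinarith [h, h', hκ]

/-- NON-VACUITY OF THE SCHEMA at gain `1`: the face section is an approximate (indeed exact) lift with `κ₀ = 1`, `η = 0`
(`BlockAveragingSection.avgFun_faceSec`, `BlockAveragingSectionPlaq.plaqSmall_faceSec`).  The content of the stub is a gain `κ₀ < L^{-1/2}`. -/
theorem approxLiftStep_one (hj : j + 1 ≤ P.m + P.K) {δ : ℝ} (hδ : 0 < δ) : ApproxLiftStep P j 1 0 δ := by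
  intro V hV
  refine ⟨BlockAveragingSection.faceSec V, ?_, fun c => ?_⟩
  · rw [one_mul]; exact BlockAveragingSectionPlaq.plaqSmall_faceSec hj hδ hV
  · rw [BlockAveragingSection.avgFun_faceSec hj _ (T3DescentFibreTower.expMeanLogSU_E_one) V, mdist_self]

end Step

/-! ## §3 The family, and the registered stub's shape -/

section Family

/-- **APPROXIMATE SMALL LIFTS FOR A FAMILY** (hypothesis schema): every run `K`, every level `j` in the standing range and every
radius `δ ∈ (0, δ₀]` admits approximate lifts with gain `κ₀` and SECOND-ORDER accuracy `C·δ²`. -/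
def ApproxSmallLift (F : T3Family) (κ₀ C δ₀ : ℝ) : Prop :=
  ∀ K j : ℕ, j + 1 ≤ (F.P K).m + (F.P K).K → ∀ δ : ℝ, 0 < δ → δ ≤ δ₀ → ApproxLiftStep (F.P K) j κ₀ (C * δ ^ 2) δ

/-- The Stokes constant is the same for every run of a family: `(5L)²/4`. -/
theorem stokes_family (F : T3Family) (K : ℕ) : stokes (F.P K) = (((5 * F.L : ℕ) : ℝ)) ^ 2 / 4 := rfl

/-- **`OneStepSmallLift ⇐ ApproxSmallLift`** with an explicit loss in the gain: for `δ₁ ≤ δ₀` small enough (depending on `L`, `κ₀`,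
`C` only) the family admits EXACT one-step lifts at all radii `≤ δ₁` with gain `κ₀ + 8·|I|·C·δ₁`. -/
theorem oneStepSmallLift_of_approx (F : T3Family) {κ₀ C δ₀ δ₁ : ℝ} (hκ₀ : 0 ≤ κ₀) (hC : 0 ≤ C) (hδ₁ : 0 < δ₁)
    (hδ₁₀ : δ₁ ≤ δ₀) (hδ₁1 : δ₁ ≤ 1)
    (hδ₁s : (((5 * F.L : ℕ) : ℝ)) ^ 2 / 4 * (κ₀ * δ₁) ≤ rhoU (36 * F.L ^ 3))
    (hδ₁a : C * δ₁ ≤ rhoU (36 * F.L ^ 3) / (2 * (36 * F.L ^ 3 : ℕ)))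
    (h : ApproxSmallLift F κ₀ C δ₀) :
    OneStepSmallLift F ℰp (κ₀ + 8 * (36 * F.L ^ 3 : ℕ) * C * δ₁) δ₁ := by
  intro K j hj δ hδ hδδ₁
  have hn : Fintype.card (Idx (F.P K)) = 36 * F.L ^ 3 := BlockAvgCorrector.card_idx_T3 F K
  have happ := h K j hj δ hδ (hδδ₁.trans hδ₁₀)
  refine smallLiftStep_of_approx hj hκ₀ hδ.le (by positivity) ?_ ?_ ?_ happ
  · rw [hn]
    calc C * δ ^ 2 = C * δ * δ := by ring
      _ ≤ C * δ₁ * 1 := by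
        refine mul_le_mul (mul_le_mul_of_nonneg_left hδδ₁ hC) (hδδ₁.trans hδ₁1) hδ.le (by positivity)
      _ = C * δ₁ := mul_one _
      _ ≤ _ := hδ₁a
  · rw [hn, stokes_family]
    exact (mul_le_mul_of_nonneg_left (mul_le_mul_of_nonneg_left hδδ₁ hκ₀) (by positivity)).trans hδ₁s
  · rw [hn]
    have : 8 * ((36 * F.L ^ 3 : ℕ) : ℝ) * (C * δ ^ 2) ≤ 8 * ((36 * F.L ^ 3 : ℕ) : ℝ) * C * δ₁ * δ := by
      have h1 : δ ^ 2 ≤ δ₁ * δ := by rw [sq]; exact mul_le_mul_of_nonneg_right hδδ₁ hδ.le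
      calc 8 * ((36 * F.L ^ 3 : ℕ) : ℝ) * (C * δ ^ 2) = (8 * ((36 * F.L ^ 3 : ℕ) : ℝ) * C) * δ ^ 2 := by ring
        _ ≤ (8 * ((36 * F.L ^ 3 : ℕ) : ℝ) * C) * (δ₁ * δ) := mul_le_mul_of_nonneg_left h1 (by positivity)
        _ = 8 * ((36 * F.L ^ 3 : ℕ) : ℝ) * C * δ₁ * δ := by ring
    calc κ₀ * δ + 8 * ((36 * F.L ^ 3 : ℕ) : ℝ) * (C * δ ^ 2) ≤ κ₀ * δ + 8 * ((36 * F.L ^ 3 : ℕ) : ℝ) * C * δ₁ * δ := by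
          linarith
      _ = (κ₀ + 8 * ((36 * F.L ^ 3 : ℕ) : ℝ) * C * δ₁) * δ := by ring

/-- **THE REGISTERED STUB'S SHAPE FROM APPROXIMATE LIFTS**: if for every block size `L` there are `κ₀` with `κ₀√L < 1` (STRICT — the
repair loses `O(δ₀)`), `C ≥ 0` and `δ₀ > 0` such that every family with `F.L = L` has approximate small lifts `ApproxSmallLift F κ₀ C δ₀`,
then the registered signature of `stub_oneStepSmallLift` holds verbatim. -/
theorem oneStepSmallLift_stub_of_approx
    (h : ∀ L : ℕ, ∃ κ₀ C δ₀ : ℝ, 0 ≤ κ₀ ∧ κ₀ * Real.sqrt L < 1 ∧ 0 ≤ C ∧ 0 < δ₀ ∧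
      ∀ F : T3Family, F.L = L → ApproxSmallLift F κ₀ C δ₀) :
    ∀ L : ℕ, ∃ κ δ₀ : ℝ, κ * Real.sqrt L ≤ 1 ∧ 0 < δ₀ ∧ ∀ F : T3Family, F.L = L → OneStepSmallLift F ℰp κ δ₀ := by
  intro L
  obtain ⟨κ₀, C, δ₀, hκ₀, hκL, hC, hδ₀, hF⟩ := h L
  set n : ℕ := 36 * L ^ 3 with hn_def
  set ρ : ℝ := rhoU n with hρ_def
  have hρ : 0 < ρ := rhoU_pos n
  set sL : ℝ := Real.sqrt L with hsL
  have hsL0 : 0 ≤ sL := Real.sqrt_nonneg _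
  have hgap : 0 < 1 - κ₀ * sL := by linarith
  -- the radius: below `δ₀`, `1`, the loop condition, the accuracy condition and the gain condition
  set A₁ : ℝ := (((5 * L : ℕ) : ℝ)) ^ 2 / 4 * κ₀ + 1 with hA₁
  set A₂ : ℝ := 2 * (n : ℝ) * C + 1 with hA₂
  set A₃ : ℝ := 8 * (n : ℝ) * C * sL + 1 with hA₃
  have hA₁pos : 0 < A₁ := by positivity
  have hA₂pos : 0 < A₂ := by positivity
  have hA₃pos : 0 < A₃ := by positivity
  set δ₁ : ℝ := min (min δ₀ 1) (min (min (ρ / A₁) (ρ / A₂)) ((1 - κ₀ * sL) / A₃)) with hδ₁_def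
  have hδ₁pos : 0 < δ₁ := by positivity
  have hδ₁₀ : δ₁ ≤ δ₀ := (min_le_left _ _).trans (min_le_left _ _)
  have hδ₁1 : δ₁ ≤ 1 := (min_le_left _ _).trans (min_le_right _ _)
  have hδ₁A₁ : δ₁ ≤ ρ / A₁ := (min_le_right _ _).trans ((min_le_left _ _).trans (min_le_left _ _))
  have hδ₁A₂ : δ₁ ≤ ρ / A₂ := (min_le_right _ _).trans ((min_le_left _ _).trans (min_le_right _ _))
  have hδ₁A₃ : δ₁ ≤ (1 - κ₀ * sL) / A₃ := (min_le_right _ _).trans (min_le_right _ _)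
  refine ⟨κ₀ + 8 * (n : ℝ) * C * δ₁, δ₁, ?_, hδ₁pos, fun F hFL => ?_⟩
  · -- the gain: `(κ₀ + 8 n C δ₁) √L ≤ 1`
    have h1 : 8 * (n : ℝ) * C * δ₁ * sL ≤ 1 - κ₀ * sL := by
      have := (le_div_iff₀ hA₃pos).mp hδ₁A₃
      nlinarith [this, hδ₁pos.le, hsL0, hC]
    nlinarith [h1]
  · subst hFL
    have hn' : (36 * F.L ^ 3 : ℕ) = n := rfl
    have h1 : (((5 * F.L : ℕ) : ℝ)) ^ 2 / 4 * (κ₀ * δ₁) ≤ rhoU (36 * F.L ^ 3) := by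
      rw [hn']
      have := (le_div_iff₀ hA₁pos).mp hδ₁A₁
      nlinarith [this, hδ₁pos.le, hκ₀]
    have h2 : C * δ₁ ≤ rhoU (36 * F.L ^ 3) / (2 * (36 * F.L ^ 3 : ℕ)) := by
      rw [hn']
      have hn0 : (0 : ℝ) < n := by
        rw [hn_def]; have := F.hL.2; positivity
      have := (le_div_iff₀ hA₂pos).mp hδ₁A₂
      rw [le_div_iff₀ (by positivity)]
      nlinarith [this, hδ₁pos.le, hC]
    have h3 := oneStepSmallLift_of_approx F hκ₀ hC hδ₁pos hδ₁₀ hδ₁1 h1 h2 (hF F rfl)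
    rw [hn'] at h3
    exact h3

end Family

end Summit.QuantumFields.YangMills.Theorems.ApproxLift

end
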